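import Mathlib
import Literature.Geometry.Riemannian.GurskyViaclovskyPath
import HarnessLib

/-!
# GurskyViaclovskyC1Estimate

Topic `Literature/Geometry/Riemannian`. Named literature fact(s) relocated by the gate from `Summits/SmoothPoincare4/SmoothPoincare4/Theorems/EntropyRungChangGurskyYangStubPathGradient.lean`
(accept-time relocation of `[cite]`d propositions written inline in a Summits proposal; human ruling 2026-08-15).
Sources: ChangGurskyYang2003, Chen2005, GuanWang2003, GurskyViaclovsky2003, LiLi2003.

* `Literature.Geometry.Riemannian.gurskyViaclovsky_gradientEstimate_weighted_four`
-/

namespace Literature.Geometry.Riemannian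

open scoped Manifold ContDiff Topology
open Set Filter
open Literature.Geometry.Lorentzian (PseudoRiemannianMetric)
open Literature.Geometry.Lorentzian.PseudoRiemannianMetric
open Literature.Geometry.Riemannian
open Literature.Geometry.Riemannian.GurskyViaclovskyPath

/-- NAMED FACT (**Gursky–Viaclovsky 2003, Prop. 5, along the Weyl-weighted path; for the
`x`-dependent weight, Chen 2005, Thm. 1(a)**). The source (J. Differential Geom. 63 (2003), §4,
Prop. 5): "Let `u_t` be a `C³` solution of (path) for some `δ ≤ t ≤ 1`, satisfying `u_t < δ̄`.
Then `‖∇u_t‖_{L^∞} < C₁`, where `C₁` depends only upon `δ̄` and `g`", (path) being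
`σ₂^{1/2}(g⁻¹A^t_{u_t}) = f(x) e^{2u_t}`, `f = σ₂^{1/2}(g⁻¹A^δ_g) > 0` (§3), with
`A^t_u = A^t_g + ∇²u + ((1−t)/2)(Δu)g + du⊗du − ((2−t)/2)|∇u|²g` (§1); proof by the maximum
principle for `|∇u|²` in normal coordinates and Lemma 2 (Li–Li 2003, after Guan–Wang 2003):
"Since we are assuming `u` is bounded above, the `|∇u|⁴` term dominates, and the proof proceeds as
in [GuanWang1] or [LiLi2]". For a right-hand side `f(x, u)` depending on the point and on the
solution, the local gradient estimate is S. Chen, IMRN 2005:63, Thm. 1(a): for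
`F(g⁻¹W) = f(x,u)·h₀`, `W = ∇²u + a(x)du⊗du + b(x)|∇u|²g + B(x)`, `b < −δ₁`, `a + n b < −δ₂`, `F`
positive, concave, monotone and homogeneous of degree one on its cone, and a `C⁴` solution on a
geodesic ball `B_r`,
"`sup_{B_{r/2}} (|∇²u| + |∇u|²) ≤ C₁(n, r, ‖a‖_{C²}, ‖b‖_{C²}, ‖B‖_{C²}, ‖g‖_{C³}, h₀, δ₁, δ₂, c_sup(r))`"
(`c_sup(r)` = the supremum over the ball of `f + |∇_x f| + |f_z| + |∇²_x f| + |∇_x f_z| + |f_zz|`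
along `(x, u(x))`), and ibid. Cor. 2, which is literally Gursky–Viaclovsky's (path):
"`σ_k^{1/k}(t λ(A_{g_u}) + s σ₁(λ(A_{g_u})) g) = f₀(x)e^{2u}` … `C = C(n, k, r, ‖g‖_{C⁴}, ‖f₀‖_{C²})`
but is independent of `t, s` and `inf f₀`".
**Vended form** — the special case the line `gv-continuity-path` consumes: dimension `n = 4`,
`C^∞` data on `ℝ⁴`-charts, the WEYL-WEIGHTED path of Chang–Gursky–Yang 2003, (1.10) (`α = 1`)
read on the conformal metric (`Literature.Geometry.Riemannian.GurskyViaclovskyPath.IsPathSolution`: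
`h = e^{−2u} g` Riemannian, `u ∈ C^∞`, `R_h > 0`, and
`P_t(h) = σ₂(A_h) − ¼|W_h|² + (1−t)(2−t)R_h²/6 = q·e^{8u}`, which on the background `g` is
`σ₂^{1/2}(g⁻¹A^t_u) = f(x,u) := ((1/16)|W_g|²_g + (q/4)e^{4u})^{1/2}` with `A^t_u ∈ Γ₂⁺`, module
docstring "Dictionary" of `GurskyViaclovskyPath.lean`; Gursky–Viaclovsky, §1: "The choice of the
right hand side in (PDE) is quite flexible; the key requirement is simply that the exponent is a
positive multiple of `u`" — in the printed proof of Prop. 5 the right side enters only through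
`u_m ∂_m(f²e^{4u})`, here `u_m∂_m ψ_W + u_m(∂_m f²)e^{4u} + 4f²e^{4u}|∇u|²`, still dominated by the
`|∇u|⁴` term under the upper bound on `u`), and as OUTPUT the sup bound on
`|∇u|²_g = g.gradSq u` under an UPPER bound `u ≤ C₀` only (as in Prop. 5; Chen's `c_sup` for
`f(x,z) = ((1/16)|W_g|²_g(x) + (q(x)/4)e^{4z})^{1/2}` is controlled on `{z ≤ C₀}` by `C₀`,
`‖q‖_{C²}`, `‖|W_g|²_g‖_{C²}`, and Cor. 2 is "independent of `inf f₀`"): on a compact `M⁴` with a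
`C^∞` Riemannian `g`, for a `C^∞` right side `q > 0`, `δ ≤ 1` and a level `C₀` there is
`C₁ = C₁(M, g, q, δ, C₀)` with `|∇u|²_g ≤ C₁` pointwise for EVERY smooth admissible solution
`(h = e^{−2u}g, u)` at any `t ∈ [δ, 1]` with `u ≤ C₀` (the compact `M` being covered by finitely
many geodesic half-balls). A deep estimate (maximum-principle computations for concave fully
nonlinear equations in normal coordinates, Guan–Wang / Li–Li); nothing of it is in Mathlib or the
tree: no `_holds`. (The body is written without scoped notation — `modelWithCornersSelf ℝ
(EuclideanSpace ℝ (Fin 4))` for `𝓡 4`, `modelWithCornersSelf ℝ ℝ` for `𝓘(ℝ)`,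
`((⊤ : ℕ∞) : WithTop ℕ∞)` for the smoothness exponent `∞` — and with fully qualified tree names,
so that it elaborates under any `open` preamble; it is syntactically the registered stub
`stub_pathGradient` of the line.) Users take `(hG : gurskyViaclovsky_gradientEstimate_weighted_four)`.
-- TODO(general form): Gursky–Viaclovsky 2003, Prop. 5 is stated for `C³` solutions of their
-- unweighted (path) with `C₁ = C₁(δ̄, g)`; Chen 2005, Thm. 1 gives LOCAL estimates
-- `sup_{B_{r/2}}(|∇²u| + |∇u|²) ≤ C` on geodesic balls, in every dimension `n`, for general
-- structure functions `F` ((S0)–(S2)), general `a(x), b(x), B(x)` and general positive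
-- `f(x,u) h(x,∇u)` (cases (a)–(c)); only the global `n = 4`, `σ₂`, Weyl-weighted gradient
-- consequence under an upper bound on `u` is stated.
[cite: GurskyViaclovsky2003, Prop. 5 and Lemma 2 (§4), §1 (PDE)] [cite: Chen2005, Thm. 1(a) and Cor. 2]
[cite: GuanWang2003] [cite: LiLi2003] [cite: ChangGurskyYang2003, (1.10)]
[file Geometry/Riemannian/GurskyViaclovskyC1Estimate] -/
def gurskyViaclovsky_gradientEstimate_weighted_four : Prop :=
  ∀ (M : Type) [TopologicalSpace M] [T2Space M] [SecondCountableTopology M]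
    [ChartedSpace (EuclideanSpace ℝ (Fin 4)) M]
    [IsManifold (modelWithCornersSelf ℝ (EuclideanSpace ℝ (Fin 4))) ((⊤ : ℕ∞) : WithTop ℕ∞) M]
    [CompactSpace M]
    (g : Literature.Geometry.Lorentzian.PseudoRiemannianMetric
      (modelWithCornersSelf ℝ (EuclideanSpace ℝ (Fin 4))) ((⊤ : ℕ∞) : WithTop ℕ∞)
      (EuclideanSpace ℝ (Fin 4))
      (TangentSpace (modelWithCornersSelf ℝ (EuclideanSpace ℝ (Fin 4))) : M → Type _))
    [g.HasLeviCivita], g.IsRiemannian →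
    ∀ (q : M → ℝ) (δ C₀ : ℝ),
      ContMDiff (modelWithCornersSelf ℝ (EuclideanSpace ℝ (Fin 4))) (modelWithCornersSelf ℝ ℝ)
        ((⊤ : ℕ∞) : WithTop ℕ∞) q →
      (∀ x, 0 < q x) → δ ≤ 1 →
      ∃ C₁ : ℝ, ∀ t : ℝ, δ ≤ t → t ≤ 1 →
        ∀ (h : Literature.Geometry.Lorentzian.PseudoRiemannianMetric
            (modelWithCornersSelf ℝ (EuclideanSpace ℝ (Fin 4))) ((⊤ : ℕ∞) : WithTop ℕ∞)
            (EuclideanSpace ℝ (Fin 4))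
            (TangentSpace (modelWithCornersSelf ℝ (EuclideanSpace ℝ (Fin 4))) : M → Type _))
          [h.HasLeviCivita] (u : M → ℝ),
          Literature.Geometry.Riemannian.GurskyViaclovskyPath.IsPathSolution g h u t q →
          (∀ x, u x ≤ C₀) →
          ∀ x, g.gradSq u x ≤ C₁

end Literature.Geometry.Riemannian
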